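import Mathlib
import HarnessLib
import Literature.Geometry.DiscreteGeometry.BondGraph
import Literature.Geometry.DiscreteGeometry.KissingPatterns
import Summits.AtomisticToContinuum.Crystallization.Theorems.PricedLinkCensusSoftLayerPropagationStubMetricScaled

/-!
# Site-level tools for the ordered-caps lemma (crux `SoftLayerPropagation`, line `Sketch`, stub `develop_H1R`)

Route `PricedLinkCensus`, crux `SoftLayerPropagation` (stmt-AtomisticToContinuum-14233), line `Sketch`.
Helper file for the registered stub `develop_H1R` (metric ordered caps).  Small lemmas used by the
machine-generated per-class site lemmas: (i) at the unit `ℓ = nn_t/1.01` of the anchor site `t`, every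
bond with an end of scale in `[ℓ, 1.0201 ℓ]` has rescaled squared length in `[1, 1 + 77/1250]`, two bonds
at a common vertex of scale `≤ 1.0304 ℓ` have rescaled squared lengths within `107/5000`, distinct sites
are `≥ 1` apart (`h1r_winL/R`, `h1r_svLL/…`, `h1r_floorL/R`, scale bookkeeping `h1r_nbr_scale`,
`h1r_far_scale`); (ii) rescaling of the premises of the stub (`h1r_prem_rescale`, `h1r_r_lower`);
(iii) norm bookkeeping for offset vectors (`h1r_norm_combo*`); (iv) the two ROW LEMMAS turning a premise
`‖E + w‖ ≤ ‖E‖ + c` / `‖E‖ ≤ ‖E + w‖ + c` about a cluster vector `w = Σ oᵢ nᵢ + ε` into a linear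
inequality for the frame coordinates `⟪E, nᵢ⟫` (`h1r_row_near`, `h1r_row_far`, and the box
`h1r_box`).  All `[folklore]`.
-/

noncomputable section

namespace Summit.AtomisticToContinuum.Crystallization.Theorems

open Literature.Geometry.DiscreteGeometry RealInnerProductSpace

variable {η : ℝ} {N : ℕ} {y : Fin N → EuclideanSpace ℝ (Fin 3)}

/-! ### Scales at the unit `ℓ = nn_t / 1.01` -/

/-- The anchor site itself: `ℓ ≤ nn_t ≤ 1.0201 ℓ` (trivially). [folklore] -/
theorem h1r_self_scale {t : Fin N} {ℓ : ℝ} (hℓ : nearestDist y t = 101 / 100 * ℓ) :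
    ℓ ≤ nearestDist y t ∧ nearestDist y t ≤ 10201 / 10000 * ℓ := by
  have h0 := nearestDist_nonneg y t
  constructor <;> nlinarith

/-- A bond-neighbour `v` of the anchor site `t` has `ℓ ≤ nn_v ≤ 1.0201 ℓ`. [folklore] -/
theorem h1r_nbr_scale (hη : 0 ≤ η) (hη' : η ≤ 1 / 100) {t v : Fin N} {ℓ : ℝ}
    (h : (bondGraph η y).Adj t v) (hℓ : nearestDist y t = 101 / 100 * ℓ) :
    ℓ ≤ nearestDist y v ∧ nearestDist y v ≤ 10201 / 10000 * ℓ := by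
  have h1 := nearestDist_le_mul_of_adj (by linarith) h
  have h2 := nearestDist_le_mul_of_adj (by linarith) h.symm
  have hv := nearestDist_nonneg y v
  have ht := nearestDist_nonneg y t
  have e1 : (1 + η) * nearestDist y v ≤ 101 / 100 * nearestDist y v :=
    mul_le_mul_of_nonneg_right (by linarith) hv
  have e2 : (1 + η) * nearestDist y t ≤ 101 / 100 * nearestDist y t :=
    mul_le_mul_of_nonneg_right (by linarith) ht
  constructor <;> nlinarith

/-- A bond-neighbour `z` of a site `a` of scale in `[ℓ, 1.0201 ℓ]` has `nn_z ≤ 1.0304 ℓ` and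
`ℓ ≤ 1.01 nn_z`. [folklore] -/
theorem h1r_far_scale (hη : 0 ≤ η) (hη' : η ≤ 1 / 100) {a z : Fin N} {ℓ : ℝ}
    (h : (bondGraph η y).Adj a z) (ha : ℓ ≤ nearestDist y a ∧ nearestDist y a ≤ 10201 / 10000 * ℓ) :
    nearestDist y z ≤ 10304 / 10000 * ℓ ∧ ℓ ≤ 101 / 100 * nearestDist y z := by
  have h1 := nearestDist_le_mul_of_adj (by linarith) h
  have h2 := nearestDist_le_mul_of_adj (by linarith) h.symm
  have hz := nearestDist_nonneg y z
  have ha0 := nearestDist_nonneg y a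
  have e1 : (1 + η) * nearestDist y z ≤ 101 / 100 * nearestDist y z :=
    mul_le_mul_of_nonneg_right (by linarith) hz
  have e2 : (1 + η) * nearestDist y a ≤ 101 / 100 * nearestDist y a :=
    mul_le_mul_of_nonneg_right (by linarith) ha0
  constructor <;> nlinarith [ha.1, ha.2]

/-! ### Windows, same-vertex differences, floors (rescaled by `ℓ⁻¹`) -/

/-- A bond at a vertex of scale `s` has length in `[s, 1.01 s]` (both orientations). [folklore] -/
theorem h1r_bond_len (hη : 0 ≤ η) (hη' : η ≤ 1 / 100) {j l : Fin N} (h : (bondGraph η y).Adj j l) :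
    nearestDist y j ≤ dist (y j) (y l) ∧ dist (y j) (y l) ≤ 101 / 100 * nearestDist y j := by
  obtain ⟨hne, hle⟩ := bondGraph_adj.1 h
  have lo : nearestDist y j ≤ dist (y j) (y l) := nearestDist_le_dist y hne.symm
  have hj := nearestDist_nonneg y j
  have hi : dist (y j) (y l) ≤ 101 / 100 * nearestDist y j :=
    calc dist (y j) (y l) ≤ (1 + η) * min (nearestDist y j) (nearestDist y l) := hle
      _ ≤ (1 + η) * nearestDist y j := mul_le_mul_of_nonneg_left (min_le_left _ _) (by linarith)
      _ ≤ 101 / 100 * nearestDist y j := mul_le_mul_of_nonneg_right (by linarith) hj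
  exact ⟨lo, hi⟩

/-- **Edge window, scale at the left end.** [folklore] -/
theorem h1r_winL (hη : 0 ≤ η) (hη' : η ≤ 1 / 100) {j l : Fin N} {ℓ : ℝ} (hℓ : 0 < ℓ)
    (h : (bondGraph η y).Adj j l) (hj : ℓ ≤ nearestDist y j ∧ nearestDist y j ≤ 10201 / 10000 * ℓ) :
    1 ≤ ‖ℓ⁻¹ • y j - ℓ⁻¹ • y l‖ ^ 2 ∧ ‖ℓ⁻¹ • y j - ℓ⁻¹ • y l‖ ^ 2 ≤ 1 + (77 / 1250 : ℝ) := by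
  obtain ⟨lo, hi⟩ := h1r_bond_len hη hη' h
  have h₁ : ℓ ≤ dist (y j) (y l) := hj.1.trans lo
  have h₂ : dist (y j) (y l) ≤ (1 + 30301 / 1000000) * ℓ := by nlinarith [hj.2]
  obtain ⟨w1, w2⟩ := window_rescale hℓ h₁ h₂
  exact ⟨w1, w2.trans (by norm_num)⟩

/-- **Edge window, scale at the right end.** [folklore] -/
theorem h1r_winR (hη : 0 ≤ η) (hη' : η ≤ 1 / 100) {j l : Fin N} {ℓ : ℝ} (hℓ : 0 < ℓ)
    (h : (bondGraph η y).Adj j l) (hl : ℓ ≤ nearestDist y l ∧ nearestDist y l ≤ 10201 / 10000 * ℓ) :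
    1 ≤ ‖ℓ⁻¹ • y j - ℓ⁻¹ • y l‖ ^ 2 ∧ ‖ℓ⁻¹ • y j - ℓ⁻¹ • y l‖ ^ 2 ≤ 1 + (77 / 1250 : ℝ) := by
  obtain ⟨lo, hi⟩ := h1r_bond_len hη hη' h.symm
  rw [dist_comm] at lo hi
  have h₁ : ℓ ≤ dist (y j) (y l) := hl.1.trans lo
  have h₂ : dist (y j) (y l) ≤ (1 + 30301 / 1000000) * ℓ := by nlinarith [hl.2]
  obtain ⟨w1, w2⟩ := window_rescale hℓ h₁ h₂
  exact ⟨w1, w2.trans (by norm_num)⟩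

/-- **Same-vertex difference** (vertex on the left in both terms). [folklore] -/
theorem h1r_svLL (hη : 0 ≤ η) (hη' : η ≤ 1 / 100) {v w₁ w₂ : Fin N} {ℓ : ℝ} (hℓ : 0 < ℓ)
    (h₁ : (bondGraph η y).Adj v w₁) (h₂ : (bondGraph η y).Adj v w₂)
    (hv : nearestDist y v ≤ 10304 / 10000 * ℓ) :
    |‖ℓ⁻¹ • y v - ℓ⁻¹ • y w₁‖ ^ 2 - ‖ℓ⁻¹ • y v - ℓ⁻¹ • y w₂‖ ^ 2| ≤ (107 / 5000 : ℝ) := by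
  obtain ⟨lo1, hi1⟩ := h1r_bond_len hη hη' h₁
  obtain ⟨lo2, hi2⟩ := h1r_bond_len hη hη' h₂
  have hs := nearestDist_nonneg y v
  have d1 := dist_nonneg (x := y v) (y := y w₁)
  have d2 := dist_nonneg (x := y v) (y := y w₂)
  have key : |dist (y v) (y w₁) ^ 2 - dist (y v) (y w₂) ^ 2| ≤ (107 / 5000 : ℝ) * ℓ ^ 2 := by
    rw [abs_le]
    constructor <;> nlinarith [mul_le_mul hi1 hi1 d1 (by positivity), mul_le_mul lo1 lo1 hs d1,
      mul_le_mul hi2 hi2 d2 (by positivity), mul_le_mul lo2 lo2 hs d2, mul_le_mul hv hv hs (by positivity)]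
  rw [norm_inv_smul_sub_sq hℓ, norm_inv_smul_sub_sq hℓ, ← sub_div, abs_div, abs_of_pos (pow_pos hℓ 2),
    div_le_iff₀ (pow_pos hℓ 2)]
  exact key

/-- Same-vertex difference, orientations `L R`. [folklore] -/
theorem h1r_svLR (hη : 0 ≤ η) (hη' : η ≤ 1 / 100) {v w₁ w₂ : Fin N} {ℓ : ℝ} (hℓ : 0 < ℓ)
    (h₁ : (bondGraph η y).Adj v w₁) (h₂ : (bondGraph η y).Adj v w₂)
    (hv : nearestDist y v ≤ 10304 / 10000 * ℓ) :
    |‖ℓ⁻¹ • y v - ℓ⁻¹ • y w₁‖ ^ 2 - ‖ℓ⁻¹ • y w₂ - ℓ⁻¹ • y v‖ ^ 2| ≤ (107 / 5000 : ℝ) := by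
  rw [norm_sub_rev (ℓ⁻¹ • y w₂)]; exact h1r_svLL hη hη' hℓ h₁ h₂ hv

/-- Same-vertex difference, orientations `R L`. [folklore] -/
theorem h1r_svRL (hη : 0 ≤ η) (hη' : η ≤ 1 / 100) {v w₁ w₂ : Fin N} {ℓ : ℝ} (hℓ : 0 < ℓ)
    (h₁ : (bondGraph η y).Adj v w₁) (h₂ : (bondGraph η y).Adj v w₂)
    (hv : nearestDist y v ≤ 10304 / 10000 * ℓ) :
    |‖ℓ⁻¹ • y w₁ - ℓ⁻¹ • y v‖ ^ 2 - ‖ℓ⁻¹ • y v - ℓ⁻¹ • y w₂‖ ^ 2| ≤ (107 / 5000 : ℝ) := by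
  rw [norm_sub_rev (ℓ⁻¹ • y w₁)]; exact h1r_svLL hη hη' hℓ h₁ h₂ hv

/-- Same-vertex difference, orientations `R R`. [folklore] -/
theorem h1r_svRR (hη : 0 ≤ η) (hη' : η ≤ 1 / 100) {v w₁ w₂ : Fin N} {ℓ : ℝ} (hℓ : 0 < ℓ)
    (h₁ : (bondGraph η y).Adj v w₁) (h₂ : (bondGraph η y).Adj v w₂)
    (hv : nearestDist y v ≤ 10304 / 10000 * ℓ) :
    |‖ℓ⁻¹ • y w₁ - ℓ⁻¹ • y v‖ ^ 2 - ‖ℓ⁻¹ • y w₂ - ℓ⁻¹ • y v‖ ^ 2| ≤ (107 / 5000 : ℝ) := by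
  rw [norm_sub_rev (ℓ⁻¹ • y w₁), norm_sub_rev (ℓ⁻¹ • y w₂)]; exact h1r_svLL hη hη' hℓ h₁ h₂ hv

/-- **Floor** from the hard core at the left end. [folklore] -/
theorem h1r_floorL {j l : Fin N} {ℓ : ℝ} (hℓ : 0 < ℓ) (hne : j ≠ l) (hj : ℓ ≤ nearestDist y j) :
    1 ≤ ‖ℓ⁻¹ • y j - ℓ⁻¹ • y l‖ ^ 2 :=
  floor_rescale hℓ (hj.trans (nearestDist_le_dist y hne.symm))

/-- **Floor** from the hard core at the right end. [folklore] -/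
theorem h1r_floorR {j l : Fin N} {ℓ : ℝ} (hℓ : 0 < ℓ) (hne : j ≠ l) (hl : ℓ ≤ nearestDist y l) :
    1 ≤ ‖ℓ⁻¹ • y j - ℓ⁻¹ • y l‖ ^ 2 := by
  rw [norm_sub_rev]; exact h1r_floorL hℓ hne.symm hl

/-! ### Rescaling the premises -/

/-- Rescaled distances. [folklore] -/
theorem h1r_dist_rescale {ℓ : ℝ} (hℓ : 0 < ℓ) (p q : EuclideanSpace ℝ (Fin 3)) :
    dist (ℓ⁻¹ • p) (ℓ⁻¹ • q) = dist p q / ℓ := by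
  rw [dist_smul₀, Real.norm_eq_abs, abs_of_pos (inv_pos.2 hℓ), div_eq_inv_mul]

/-- A premise `dist p q ≤ dist p' q' + c · s` rescales to the unit `ℓ`. [folklore] -/
theorem h1r_prem_rescale {ℓ : ℝ} (hℓ : 0 < ℓ) {p q p' q' : EuclideanSpace ℝ (Fin 3)} {c s : ℝ}
    (h : dist p q ≤ dist p' q' + c * s) :
    dist (ℓ⁻¹ • p) (ℓ⁻¹ • q) ≤ dist (ℓ⁻¹ • p') (ℓ⁻¹ • q') + c * (s / ℓ) := by
  rw [h1r_dist_rescale hℓ, h1r_dist_rescale hℓ, show c * (s / ℓ) = c * s / ℓ by ring, ← add_div]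
  exact div_le_div_of_nonneg_right h hℓ.le

/-- The observer is at least `nn_u / ℓ` from `u` (rescaled hard core). [folklore] -/
theorem h1r_r_lower {i u : Fin N} {ℓ : ℝ} (hℓ : 0 < ℓ) (hne : u ≠ i) :
    nearestDist y u / ℓ ≤ dist (ℓ⁻¹ • y i) (ℓ⁻¹ • y u) := by
  rw [h1r_dist_rescale hℓ, dist_comm]
  exact div_le_div_of_nonneg_right (nearestDist_le_dist y hne.symm) hℓ.le

/-- The rescaled scale of a neighbour of `t` lies in `[1, 1.0201]`. [folklore] -/
theorem h1r_nu_bounds {u : Fin N} {ℓ : ℝ} (hℓ : 0 < ℓ)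
    (hu : ℓ ≤ nearestDist y u ∧ nearestDist y u ≤ 10201 / 10000 * ℓ) :
    1 ≤ nearestDist y u / ℓ ∧ nearestDist y u / ℓ ≤ 10201 / 10000 := by
  constructor
  · rw [le_div_iff₀ hℓ, one_mul]; exact hu.1
  · rw [div_le_iff₀ hℓ]; exact hu.2

/-- A-priori bounds rescale: `‖v‖ ≤ C ℓ` gives `‖ℓ⁻¹ • v‖ ≤ C`. [folklore] -/
theorem h1r_apriori_rescale {ℓ C : ℝ} (hℓ : 0 < ℓ) {v : EuclideanSpace ℝ (Fin 3)} (h : ‖v‖ ≤ C * ℓ) :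
    ‖ℓ⁻¹ • v‖ ≤ C := by
  rw [norm_smul, Real.norm_eq_abs, abs_of_pos (inv_pos.2 hℓ), inv_mul_le_iff₀ hℓ, mul_comm]
  exact h

/-! ### Norm bookkeeping -/

/-- The centre identities of the sharp octahedron lemma in norm form. [folklore] -/
theorem h1r_two_beta {v : EuclideanSpace ℝ (Fin 3)} (h : ‖v‖ ^ 2 ≤ 4 * (107 / 5000 : ℝ) ^ 2) :
    ‖v‖ ≤ 107 / 2500 :=
  (pow_le_pow_iff_left₀ (norm_nonneg _) (by norm_num) two_ne_zero).1 (h.trans_eq (by norm_num))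

/-- Norm of a one-term combination. [folklore] -/
theorem h1r_norm_combo1 {e a₁ : EuclideanSpace ℝ (Fin 3)} {s₁ A₁ : ℝ}
    (h : e = s₁ • a₁) (h₁ : ‖a₁‖ ≤ A₁) : ‖e‖ ≤ |s₁| * A₁ := by
  rw [h, norm_smul, Real.norm_eq_abs]
  exact mul_le_mul_of_nonneg_left h₁ (abs_nonneg _)

/-- Norm of a two-term combination. [folklore] -/
theorem h1r_norm_combo2 {e a₁ a₂ : EuclideanSpace ℝ (Fin 3)} {s₁ s₂ A₁ A₂ : ℝ}
    (h : e = s₁ • a₁ + s₂ • a₂) (h₁ : ‖a₁‖ ≤ A₁) (h₂ : ‖a₂‖ ≤ A₂) :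
    ‖e‖ ≤ |s₁| * A₁ + |s₂| * A₂ := by
  rw [h]
  refine (norm_add_le _ _).trans (add_le_add ?_ ?_) <;> rw [norm_smul, Real.norm_eq_abs]
  · exact mul_le_mul_of_nonneg_left h₁ (abs_nonneg _)
  · exact mul_le_mul_of_nonneg_left h₂ (abs_nonneg _)

/-- Norm of a three-term combination. [folklore] -/
theorem h1r_norm_combo3 {e a₁ a₂ a₃ : EuclideanSpace ℝ (Fin 3)} {s₁ s₂ s₃ A₁ A₂ A₃ : ℝ}
    (h : e = s₁ • a₁ + s₂ • a₂ + s₃ • a₃) (h₁ : ‖a₁‖ ≤ A₁) (h₂ : ‖a₂‖ ≤ A₂) (h₃ : ‖a₃‖ ≤ A₃) :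
    ‖e‖ ≤ |s₁| * A₁ + |s₂| * A₂ + |s₃| * A₃ := by
  have h' : e = (1 : ℝ) • (s₁ • a₁ + s₂ • a₂) + s₃ • a₃ := by rw [h, one_smul]
  have := h1r_norm_combo2 h' (h1r_norm_combo2 rfl h₁ h₂) h₃
  simpa using this

/-- Norm of a four-term combination. [folklore] -/
theorem h1r_norm_combo4 {e a₁ a₂ a₃ a₄ : EuclideanSpace ℝ (Fin 3)} {s₁ s₂ s₃ s₄ A₁ A₂ A₃ A₄ : ℝ}
    (h : e = s₁ • a₁ + s₂ • a₂ + s₃ • a₃ + s₄ • a₄) (h₁ : ‖a₁‖ ≤ A₁) (h₂ : ‖a₂‖ ≤ A₂) (h₃ : ‖a₃‖ ≤ A₃)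
    (h₄ : ‖a₄‖ ≤ A₄) : ‖e‖ ≤ |s₁| * A₁ + |s₂| * A₂ + |s₃| * A₃ + |s₄| * A₄ := by
  have h' : e = (1 : ℝ) • (s₁ • a₁ + s₂ • a₂ + s₃ • a₃) + s₄ • a₄ := by rw [h, one_smul]
  have := h1r_norm_combo2 h' (h1r_norm_combo3 rfl h₁ h₂ h₃) h₄
  simpa using this

/-- Norm of a five-term combination. [folklore] -/
theorem h1r_norm_combo5 {e a₁ a₂ a₃ a₄ a₅ : EuclideanSpace ℝ (Fin 3)} {s₁ s₂ s₃ s₄ s₅ A₁ A₂ A₃ A₄ A₅ : ℝ}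
    (h : e = s₁ • a₁ + s₂ • a₂ + s₃ • a₃ + s₄ • a₄ + s₅ • a₅) (h₁ : ‖a₁‖ ≤ A₁) (h₂ : ‖a₂‖ ≤ A₂)
    (h₃ : ‖a₃‖ ≤ A₃) (h₄ : ‖a₄‖ ≤ A₄) (h₅ : ‖a₅‖ ≤ A₅) :
    ‖e‖ ≤ |s₁| * A₁ + |s₂| * A₂ + |s₃| * A₃ + |s₄| * A₄ + |s₅| * A₅ := by
  have h' : e = (1 : ℝ) • (s₁ • a₁ + s₂ • a₂ + s₃ • a₃ + s₄ • a₄) + s₅ • a₅ := by rw [h, one_smul]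
  have := h1r_norm_combo2 h' (h1r_norm_combo4 rfl h₁ h₂ h₃ h₄) h₅
  simpa using this

/-! ### The row lemmas -/

/-- Distances to the observer through the vector `E = a − p`: `dist p w = ‖E + (w − a)‖`. [folklore] -/
theorem h1r_dist_eq (a p w : EuclideanSpace ℝ (Fin 3)) : dist p w = ‖(a - p) + (w - a)‖ := by
  rw [dist_eq_norm, ← norm_neg]; congr 1; abel

/-- `dist p a = ‖a − p‖`. [folklore] -/
theorem h1r_dist_eq' (a p : EuclideanSpace ℝ (Fin 3)) : dist p a = ‖a - p‖ := by
  rw [dist_comm, dist_eq_norm]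

/-- The inner product of `E` with a decomposed cluster vector. [folklore] -/
theorem h1r_inner_decomp (E w ε n₁ n₂ n₃ : EuclideanSpace ℝ (Fin 3)) {o₁ o₂ o₃ d : ℝ}
    (hw : w = o₁ • n₁ + o₂ • n₂ + o₃ • n₃ + ε) (hε : ‖ε‖ ≤ d) :
    |inner ℝ E w - (o₁ * inner ℝ E n₁ + o₂ * inner ℝ E n₂ + o₃ * inner ℝ E n₃)| ≤ ‖E‖ * d := by
  have e : inner ℝ E w - (o₁ * inner ℝ E n₁ + o₂ * inner ℝ E n₂ + o₃ * inner ℝ E n₃) = inner ℝ E ε := by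
    rw [hw, inner_add_right, inner_add_right, inner_add_right, real_inner_smul_right,
      real_inner_smul_right, real_inner_smul_right]; ring
  rw [e]
  exact (abs_real_inner_le_norm _ _).trans (mul_le_mul_of_nonneg_left hε (norm_nonneg _))

/-- **Row lemma, near side** (`k` not farther): from `‖E + w‖ ≤ ‖E‖ + c`. [folklore] -/
theorem h1r_row_near (E w ε n₁ n₂ n₃ : EuclideanSpace ℝ (Fin 3)) {o₁ o₂ o₃ d A c : ℝ}
    (hw : w = o₁ • n₁ + o₂ • n₂ + o₃ • n₃ + ε) (hε : ‖ε‖ ≤ d) (hA : A ≤ ‖w‖ ^ 2)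
    (h : ‖E + w‖ ≤ ‖E‖ + c) :
    o₁ * inner ℝ E n₁ + o₂ * inner ℝ E n₂ + o₃ * inner ℝ E n₃ + (A - c ^ 2) / 2 ≤ (c + d) * ‖E‖ := by
  have hd := abs_le.1 (h1r_inner_decomp E w ε n₁ n₂ n₃ hw hε)
  have hsq : ‖E + w‖ ^ 2 ≤ (‖E‖ + c) ^ 2 := pow_le_pow_left₀ (norm_nonneg _) h 2
  rw [norm_add_sq_real] at hsq
  nlinarith [hd.1, hd.2, norm_nonneg E]

/-- **Row lemma, far side** (`t` / a candidate not nearer): from `‖E‖ ≤ ‖E + w‖ + c` with `c ≤ ‖E‖`.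
[folklore] -/
theorem h1r_row_far (E w ε n₁ n₂ n₃ : EuclideanSpace ℝ (Fin 3)) {o₁ o₂ o₃ d G c : ℝ}
    (hw : w = o₁ • n₁ + o₂ • n₂ + o₃ • n₃ + ε) (hε : ‖ε‖ ≤ d) (hG : ‖w‖ ^ 2 ≤ G) (hcE : c ≤ ‖E‖)
    (h : ‖E‖ ≤ ‖E + w‖ + c) :
    -(o₁ * inner ℝ E n₁ + o₂ * inner ℝ E n₂ + o₃ * inner ℝ E n₃) - (G - c ^ 2) / 2 ≤ (c + d) * ‖E‖ := by
  have hd := abs_le.1 (h1r_inner_decomp E w ε n₁ n₂ n₃ hw hε)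
  have h0 : 0 ≤ ‖E‖ - c := by linarith
  have hsq : (‖E‖ - c) ^ 2 ≤ ‖E + w‖ ^ 2 := pow_le_pow_left₀ h0 (by linarith) 2
  rw [norm_add_sq_real] at hsq
  nlinarith [hd.1, hd.2, norm_nonneg E]

/-- **The box**: `|⟪E, n⟫| ≤ B ‖E‖` when `‖n‖² ≤ B²`. [folklore] -/
theorem h1r_box (E n : EuclideanSpace ℝ (Fin 3)) {B : ℝ} (hB : 0 ≤ B) (hn : ‖n‖ ^ 2 ≤ B ^ 2) :
    inner ℝ E n ≤ B * ‖E‖ ∧ -inner ℝ E n ≤ B * ‖E‖ := by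
  have hn' : ‖n‖ ≤ B := (pow_le_pow_iff_left₀ (norm_nonneg _) hB two_ne_zero).1 hn
  have h := abs_le.1 ((abs_real_inner_le_norm E n).trans
    (by rw [mul_comm]; exact mul_le_mul_of_nonneg_right hn' (norm_nonneg _) : ‖E‖ * ‖n‖ ≤ B * ‖E‖))
  exact ⟨h.2, by linarith [h.1]⟩

/-- Lower bound on the squared length of a decomposed vector from a lower bound `m ≤ ‖Σ oᵢ nᵢ‖` and
the tolerance `d ≤ m`. [folklore] -/
theorem h1r_normsq_lower {w v ε : EuclideanSpace ℝ (Fin 3)} {m d : ℝ} (hw : w = v + ε) (hm : m ≤ ‖v‖)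
    (hε : ‖ε‖ ≤ d) (hdm : d ≤ m) : (m - d) ^ 2 ≤ ‖w‖ ^ 2 := by
  have h1 : m - d ≤ ‖w‖ := by
    have : ‖v‖ - ‖ε‖ ≤ ‖v + ε‖ := by
      have := norm_sub_norm_le v (v + ε); rw [show v - (v + ε) = -ε by abel, norm_neg] at this; linarith
    rw [hw]; linarith
  exact pow_le_pow_left₀ (by linarith) h1 2

/-- Squared length of a frame combination from the Gram data (lower bound). [folklore] -/
theorem h1r_frame_combo_sq (n₁ n₂ n₃ : EuclideanSpace ℝ (Fin 3)) (o₁ o₂ o₃ : ℝ) :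
    ‖o₁ • n₁ + o₂ • n₂ + o₃ • n₃‖ ^ 2 = o₁ ^ 2 * ‖n₁‖ ^ 2 + o₂ ^ 2 * ‖n₂‖ ^ 2 + o₃ ^ 2 * ‖n₃‖ ^ 2 +
      2 * (o₁ * o₂) * inner ℝ n₁ n₂ + 2 * (o₂ * o₃) * inner ℝ n₂ n₃ + 2 * (o₁ * o₃) * inner ℝ n₃ n₁ := by
  simp only [Literature.Algebra.EuclideanLattices.inner_fin_three,
    Literature.Algebra.EuclideanLattices.norm_sq_fin_three, PiLp.add_apply, PiLp.smul_apply, smul_eq_mul]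
  ring

/-- **Registered principal of this tools file (`h1r_site_tools`)**: the box inequality in arrow form
(the other lemmas of the file are the tools listed in the module docstring). [folklore] -/
theorem h1r_site_tools : ∀ (E n : EuclideanSpace ℝ (Fin 3)) (B : ℝ), 0 ≤ B → ‖n‖ ^ 2 ≤ B ^ 2 → inner ℝ E n ≤ B * ‖E‖ ∧ -inner ℝ E n ≤ B * ‖E‖ :=
  fun E n _ hB hn => h1r_box E n hB hn

end Summit.AtomisticToContinuum.Crystallization.Theorems

end
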